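import Mathlib

/-!
# Carleman convergence condition ⇒ mean-subcriticality (staging, deq-2 / DEQ-A147 Prop. A147-D)

HONEST FRAMING: instance-level adjudication of specific advantage claims; no claim about
BQP vs BPP or the summit.

Setting.  D. An, K. Trivisa, *Quantum algorithms for linear and non-linear fractional
reaction-diffusion equations*, Quantum 10, 1969 (2026) = arXiv:2310.18900v2, §5 (CLAIMS row A-147).
After the spectral semi-discretisation of `∂ₜu = −(−Δ)^{α/2} u − c u + a u(1 − u)` on the torus with
`N^d` grid points, the linear part of the quadratic ODE system is `F₁ = aI − B − C` (v2 p. 23,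
held text p0018 L21), where `B` is the real symmetric positive-semidefinite matrix of the discretised
fractional Laplacian — its kernel contains the constant grid vector `𝟙` because the `k = 0` Fourier
multiplier `(2π‖0‖)^α` vanishes — and `C = diag (c(x_j))`.  The paper's Carleman / truncated-Dyson
solver 'requires Ã to have non-positive logarithmic norm, which can be guaranteed if all the
eigenvalues of F₁ are negative and F₂ is bounded … (namely the condition R_D < 1 in
[AnFangJordanEtAl2022])' (held text p0019 L51).

Content (all PROVED, elementary linear algebra; `B` is an ARBITRARY real matrix with `B *ᵥ 𝟙 = 0`,
no discretisation is formalised):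

* `card_mul_lt_sum_of_posDef` : `(B + diagonal c − a • 1).PosDef → a · |n| < Σ c`
  (the quadratic form at `𝟙`);
* `card_mul_le_sum_of_posSemidef` : `(B + diagonal c − μ • 1).PosSemidef → μ · |n| ≤ Σ c`
  (every lower spectral bound `μ` of `B + C` is at most the mean of `c`; i.e. `λ_min(B + C) ≤ mean c`);
* `posDef_neg_of_eigenvalues_neg` : a Hermitian real matrix whose `IsHermitian.eigenvalues` are all
  negative has positive-definite negation (spectral theorem, as in Mathlib's
  `IsHermitian.posDef_iff_eigenvalues_pos`);
* `card_mul_lt_sum_of_eigenvalues_neg` / `lt_mean_of_eigenvalues_neg` : LITERALLY the paper's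
  hypothesis — `F₁ = a • 1 − B − diagonal c` Hermitian with all eigenvalues `< 0` — implies
  `a · |n| < Σ c`, i.e. `a < mean c`.

Interpretation (DEQ-A147 §2.3 Prop. A147-D, OURS, hedged; NOT a Lean claim): for Fisher–KPP data
`0 ≤ u₀ ≤ 1`, `c ≥ 0`, `a < mean c` is first-moment subcriticality, at the uniform point, of the
McKean branching `α`-stable particle system (branch at rate `a`, kill at rate `c(x)`) whose marked-survival
probability is `u(T, x₀)`; so the regime in which the paper's nonlinear quantum solver is stated to
converge is a regime in which the classical branching Monte Carlo point estimator runs with `O(1)`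
expected particles per sample in the mean.  Only the matrix inequality is kernel-checked here.
-/

namespace Summit.QuantumAdvantage.Dequantization.CarlemanMeanSubcritical

open Matrix

variable {n : Type*} [Fintype n] [DecidableEq n]

/-- `𝟙ᵀ (diagonal c) 𝟙 = Σ c`. -/
theorem one_dotProduct_diagonal_mulVec_one (c : n → ℝ) :
    (1 : n → ℝ) ⬝ᵥ (diagonal c *ᵥ (1 : n → ℝ)) = ∑ i, c i := by
  rw [one_dotProduct]
  refine Finset.sum_congr rfl fun i _ => ?_
  rw [mulVec_diagonal]
  simp

/-- `𝟙ᵀ (a • I) 𝟙 = a · |n|`. -/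
theorem one_dotProduct_smul_one_mulVec_one (a : ℝ) :
    (1 : n → ℝ) ⬝ᵥ ((a • (1 : Matrix n n ℝ)) *ᵥ (1 : n → ℝ)) = a * Fintype.card n := by
  rw [smul_mulVec, one_mulVec, dotProduct_smul, one_dotProduct_one, smul_eq_mul]

/-- The quadratic form of `B + diagonal c − a • I` at the constant vector, when `B 𝟙 = 0`. -/
theorem one_dotProduct_mulVec_one_eq (B : Matrix n n ℝ) (c : n → ℝ) (a : ℝ)
    (hB : B *ᵥ (1 : n → ℝ) = 0) :
    (1 : n → ℝ) ⬝ᵥ ((B + diagonal c - a • (1 : Matrix n n ℝ)) *ᵥ (1 : n → ℝ))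
      = (∑ i, c i) - a * Fintype.card n := by
  rw [sub_mulVec, add_mulVec, hB, zero_add, dotProduct_sub, one_dotProduct_diagonal_mulVec_one,
    one_dotProduct_smul_one_mulVec_one]

/-- If `B 𝟙 = 0` and `B + diag c − a I` is positive definite then `a · |n| < Σ c`
(test the quadratic form at `𝟙 ≠ 0`). -/
theorem card_mul_lt_sum_of_posDef [Nonempty n] (B : Matrix n n ℝ) (c : n → ℝ) (a : ℝ)
    (hB : B *ᵥ (1 : n → ℝ) = 0) (h : (B + diagonal c - a • (1 : Matrix n n ℝ)).PosDef) :
    a * Fintype.card n < ∑ i, c i := by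
  have h1 : (1 : n → ℝ) ≠ 0 := one_ne_zero
  have hq := h.dotProduct_mulVec_pos h1
  rw [star_trivial, one_dotProduct_mulVec_one_eq B c a hB] at hq
  linarith

/-- If `B 𝟙 = 0` and `B + diag c − μ I` is positive SEMIdefinite then `μ · |n| ≤ Σ c`: every lower
spectral bound of `B + C` is at most the mean of `c` (Rayleigh quotient at `𝟙`). -/
theorem card_mul_le_sum_of_posSemidef (B : Matrix n n ℝ) (c : n → ℝ) (μ : ℝ)
    (hB : B *ᵥ (1 : n → ℝ) = 0) (h : (B + diagonal c - μ • (1 : Matrix n n ℝ)).PosSemidef) :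
    μ * Fintype.card n ≤ ∑ i, c i := by
  have hq := h.dotProduct_mulVec_nonneg (1 : n → ℝ)
  rw [star_trivial, one_dotProduct_mulVec_one_eq B c μ hB] at hq
  linarith

/-- A Hermitian real matrix all of whose eigenvalues are negative has positive-definite negation
(spectral theorem; cf. Mathlib's `Matrix.IsHermitian.posDef_iff_eigenvalues_pos`). -/
theorem posDef_neg_of_eigenvalues_neg {A : Matrix n n ℝ} (hA : A.IsHermitian)
    (hneg : ∀ i, hA.eigenvalues i < 0) : (-A).PosDef := by
  have key : -A = Unitary.conjStarAlgAut ℝ (Matrix n n ℝ) hA.eigenvectorUnitary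
      (diagonal (RCLike.ofReal ∘ (-hA.eigenvalues))) := by
    conv_lhs => rw [hA.spectral_theorem]
    rw [← map_neg]
    congr 1
    rw [diagonal_neg]
    congr 1
  rw [key]
  simp [Unitary.isUnit_coe.posDef_star_right_conjugate_iff, hneg]

/-- The paper's Carleman convergence hypothesis, literally: if `F₁ = a I − B − diag c` is Hermitian with
all eigenvalues negative and `B 𝟙 = 0`, then `a · |n| < Σ c`. -/
theorem card_mul_lt_sum_of_eigenvalues_neg [Nonempty n] (B : Matrix n n ℝ) (c : n → ℝ) (a : ℝ)
    (hB : B *ᵥ (1 : n → ℝ) = 0)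
    (hF : (a • (1 : Matrix n n ℝ) - B - diagonal c).IsHermitian)
    (hneg : ∀ i, hF.eigenvalues i < 0) :
    a * Fintype.card n < ∑ i, c i := by
  have hpd := posDef_neg_of_eigenvalues_neg hF hneg
  have e : -(a • (1 : Matrix n n ℝ) - B - diagonal c) = B + diagonal c - a • (1 : Matrix n n ℝ) := by
    abel
  rw [e] at hpd
  exact card_mul_lt_sum_of_posDef B c a hB hpd

/-- Mean form: under the paper's hypothesis, `a < (Σ_j c_j) / |n|` (the growth rate is below the grid
mean of the potential). -/
theorem lt_mean_of_eigenvalues_neg [Nonempty n] (B : Matrix n n ℝ) (c : n → ℝ) (a : ℝ)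
    (hB : B *ᵥ (1 : n → ℝ) = 0)
    (hF : (a • (1 : Matrix n n ℝ) - B - diagonal c).IsHermitian)
    (hneg : ∀ i, hF.eigenvalues i < 0) :
    a < (∑ i, c i) / Fintype.card n := by
  have hcard : (0 : ℝ) < Fintype.card n := by exact_mod_cast Fintype.card_pos
  rw [lt_div_iff₀ hcard]
  exact card_mul_lt_sum_of_eigenvalues_neg B c a hB hF hneg

end Summit.QuantumAdvantage.Dequantization.CarlemanMeanSubcritical
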